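import Summits.HubbardSuperconductivity.HubbardLadder.Bounds.FdcShearGeometry
import Literature.MathematicalPhysics.QuantumLattice.LiebMattisMatrixElements
import Literature.MathematicalPhysics.QuantumLattice.FinDimSpectrumProofs
import HarnessLib

/-!
# The energy of a depth-2×2 plaquette-circuit state on the Heisenberg torus, in closed form

HONEST FRAMING: ladder R1–R4 with certified numbers; no claim on H/H₀; bounds for model classes,
no materials claim.

For the spin-`n/2` Heisenberg model `H = J ∑_{⟨xy⟩} S_x·S_y` on the torus `(ℤ/Lℤ)²`, `L = 2k`,
`k ≥ 3`, and the finite-depth-circuit trial state `Ψ = (⨂_{plaquettes b} u) (⨂_{clusters c} φ)`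
(`φ` a unit vector on a `2×2` cluster, `u` a unitary on a `2×2` dual plaquette; geometry of
`FdcShearGeometry`), the variational energy is computed EXACTLY by a light-cone contraction:
`Re ⟨Ψ, H Ψ⟩ = J k² Φ(φ, u)` where `Φ = fdcEnergy n φ u = ∑_{δ ∈ P, i} Re fdcBond` is a finite
closed formula in the `16 × 16`-type data — a four-fold sum over plaquette configurations of
products of one- and two-point CLUSTER FACTORS `fdcS`, `fdcD` (an intra-cluster bond meets the two
plaquettes `b, b + eᵢ`, whose light cone is six distinct clusters iff `k ≥ 3`; a seam bond lies in
one plaquette, light cone = its four corner clusters). Consequence (variational principle):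
`E₀(H_L) ≤ J k² Φ(φ, u)` — `heisenbergTorus_groundEnergy_le_fdc`. The instance files evaluate `Φ`
in exact rational arithmetic. References: tensor-network / finite-depth-circuit variational states,
Tasaki (2020) §2.5 [cite: Tasaki2020]; Anderson (1951). [folklore]
-/

namespace Summit.HubbardSuperconductivity.HubbardLadder.Bounds

open Matrix Finset Complex
open Literature.Probability.LatticeModels Literature.MathematicalPhysics.QuantumLattice
open Literature.MathematicalPhysics.QuantumLattice.HeisenbergTL

noncomputable section

/-! ### A product over all clusters supported on two injective images -/

/-- `∏_a G a = (∏_x G (f₁ x)) · ∏_{y : p y} G (f₂ y)` when `G = 1` off the two disjoint injective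
images. [folklore] -/
theorem prod_univ_eq_two_images {A ι₁ ι₂ : Type*} [Fintype A] [DecidableEq A] [Fintype ι₁]
    [DecidableEq ι₁] [Fintype ι₂] [DecidableEq ι₂] (f₁ : ι₁ → A) (f₂ : ι₂ → A) (p : ι₂ → Prop)
    [DecidablePred p] (h₁ : Function.Injective f₁) (h₂ : Function.Injective f₂)
    (hdisj : ∀ x y, p y → f₁ x ≠ f₂ y) (G : A → ℂ)
    (hG : ∀ a, (∀ x, f₁ x ≠ a) → (∀ y, p y → f₂ y ≠ a) → G a = 1) :
    ∏ a, G a = (∏ x, G (f₁ x)) * ∏ y, if p y then G (f₂ y) else 1 := by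
  set S₁ : Finset A := univ.image f₁ with hS₁
  set S₂ : Finset A := (univ.filter p).image f₂ with hS₂
  have hd : Disjoint S₁ S₂ := by
    rw [Finset.disjoint_left]
    intro a ha₁ ha₂
    obtain ⟨x, -, rfl⟩ := mem_image.1 ha₁
    obtain ⟨y, hy, hxy⟩ := mem_image.1 ha₂
    exact hdisj x y (mem_filter.1 hy).2 hxy.symm
  have hsub : ∏ a ∈ S₁ ∪ S₂, G a = ∏ a, G a := by
    refine prod_subset (subset_univ _) fun a _ ha => hG a ?_ ?_
    · intro x hx
      exact ha (mem_union_left _ (mem_image.2 ⟨x, mem_univ _, hx⟩))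
    · intro y hy hxy
      exact ha (mem_union_right _ (mem_image.2 ⟨y, mem_filter.2 ⟨mem_univ _, hy⟩, hxy⟩))
  rw [← hsub, prod_union hd, prod_image fun x _ x' _ h => h₁ h,
    prod_image fun y _ y' _ h => h₂ h, prod_filter]

/-! ### Cluster factors and the closed-form bond values -/

section Formula

variable {q : ℕ}

/-- One-point cluster factor `⟨φ, E^{(p)}_{a a'} φ⟩` (`E_{a a'} = |a⟩⟨a'|` at position `p`).
[folklore] -/
def fdcS (φ : TensorIndex FdcP q → ℂ) (p : FdcP) (a a' : Fin q) : ℂ :=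
  star φ ⬝ᵥ (onSite p (single a a' (1 : ℂ)) *ᵥ φ)

/-- Two-point cluster factor `⟨φ, E^{(p)}_{a a'} E^{(p')}_{c c'} φ⟩`. [folklore] -/
def fdcD (φ : TensorIndex FdcP q → ℂ) (p : FdcP) (a a' : Fin q) (p' : FdcP) (c c' : Fin q) : ℂ :=
  star φ ⬝ᵥ (onSite p (single a a' (1 : ℂ)) *ᵥ (onSite p' (single c c' (1 : ℂ)) *ᵥ φ))

/-- **Two-plaquette contraction sum** (intra-cluster bond in direction `i`): the plaquette
operators `X1` (on `b`) and `X2` (on `b + eᵢ`) expanded in matrix units; corner `δ'` of `b` with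
`δ'_i = 0` shares its cluster with corner `δ' + eᵢ` of `b + eᵢ` (two-point factor), the other
corners carry one-point factors. [folklore] -/
def fdcSumA (φ : TensorIndex FdcP q → ℂ) (i : Fin 2) (X1 X2 : Op FdcP q) : ℂ :=
  ∑ l₂ : TensorIndex FdcP q, ∑ l₂' : TensorIndex FdcP q,
    ∑ l₁ : TensorIndex FdcP q, ∑ l₁' : TensorIndex FdcP q,
      X2 l₂ l₂' * (X1 l₁ l₁' *
        ((∏ δ' : FdcP, if δ' i = 0 then
            fdcD φ δ' (l₁ δ') (l₁' δ') (δ' + Pi.single i 1) (l₂ (δ' + Pi.single i 1))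
              (l₂' (δ' + Pi.single i 1))
          else fdcS φ δ' (l₁ δ') (l₁' δ')) *
         ∏ δ'' : FdcP, if δ'' i = 0 then fdcS φ δ'' (l₂ δ'') (l₂' δ'') else 1))

/-- **One-plaquette contraction sum** (seam bond): `∑_{l l'} X_{l l'} ∏_{δ'} ⟨φ, E_{l δ', l' δ'} φ⟩`.
[folklore] -/
def fdcSumB (φ : TensorIndex FdcP q → ℂ) (X : Op FdcP q) : ℂ :=
  ∑ l : TensorIndex FdcP q, ∑ l' : TensorIndex FdcP q, X l l' * ∏ δ' : FdcP, fdcS φ δ' (l δ') (l' δ')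

/-- **The pair expectation** `⟨Ψ, (s at x)(s' at x + eᵢ) Ψ⟩` for a site of parity `δ`: an A-bond
(`δ_i = 0`) or a B-bond (`δ_i = 1`). [folklore] -/
def fdcPair (φ : TensorIndex FdcP q → ℂ) (u : Op FdcP q) (δ : FdcP) (i : Fin 2)
    (s s' : Matrix (Fin q) (Fin q) ℂ) : ℂ :=
  if δ i = 0 then
    fdcSumA φ i (uᴴ * onSite δ s * u) (uᴴ * onSite (δ + Pi.single i 1) s' * u)
  else fdcSumB φ (uᴴ * (onSite δ s * onSite (δ + Pi.single i 1) s') * u)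

/-- **The bond value** `⟨Ψ, S_x · S_{x+eᵢ} Ψ⟩ = ⟨SᶻSᶻ⟩ + ½(⟨S⁺S⁻⟩ + ⟨S⁻S⁺⟩)` for a site of parity
`δ`. [folklore] -/
def fdcBond (n : ℕ) (φ : TensorIndex FdcP (n + 1) → ℂ) (u : Op FdcP (n + 1)) (δ : FdcP)
    (i : Fin 2) : ℂ :=
  fdcPair φ u δ i (SpinOperators.spinZ n) (SpinOperators.spinZ n) +
    (1 / 2 : ℂ) * (fdcPair φ u δ i (spinRaise n) (spinLower n) +
      fdcPair φ u δ i (spinLower n) (spinRaise n))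

/-- **The FDC trial energy per cluster** `Φ(φ, u) = ∑_{δ, i} Re fdcBond`. [folklore] -/
def fdcEnergy (n : ℕ) (φ : TensorIndex FdcP (n + 1) → ℂ) (u : Op FdcP (n + 1)) : ℝ :=
  ∑ δ : FdcP, ∑ i : Fin 2, (fdcBond n φ u δ i).re

end Formula

/-! ### The light-cone contractions -/

section Contraction

variable {k L : ℕ} [NeZero k] [NeZero L] {q : ℕ}

omit [NeZero L] in
/-- **The six-cluster product** of an intra-cluster bond: the product over all clusters of the
corner factors of plaquettes `b` and `b + eᵢ` is the product of two-point factors over the shared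
corners and one-point factors over the others (`‖φ‖ = 1`, `k ≥ 3`). [folklore] -/
theorem fdc_prod_cornersA (hk : 3 ≤ k) (φ : TensorIndex FdcP q → ℂ) (hφ : star φ ⬝ᵥ φ = 1)
    (b : FdcA k) (i : Fin 2) (l₁ l₁' l₂ l₂' : TensorIndex FdcP q) :
    ∏ a : FdcA k, (star φ ⬝ᵥ
        (cornerOp (fdcCorner k b) id (fun g => single (l₁ g) (l₁' g) (1 : ℂ)) a *ᵥ
          (cornerOp (fdcCorner k (b + Pi.single i 1)) id
              (fun g => single (l₂ g) (l₂' g) (1 : ℂ)) a *ᵥ φ))) =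
      (∏ δ' : FdcP, if δ' i = 0 then
          fdcD φ δ' (l₁ δ') (l₁' δ') (δ' + Pi.single i 1) (l₂ (δ' + Pi.single i 1))
            (l₂' (δ' + Pi.single i 1))
        else fdcS φ δ' (l₁ δ') (l₁' δ')) *
      ∏ δ'' : FdcP, if δ'' i = 0 then fdcS φ δ'' (l₂ δ'') (l₂' δ'') else 1 := by
  have inj₁ := fdcCorner_injective hk b
  have inj₂ := fdcCorner_injective hk (b + Pi.single i 1)
  rw [prod_univ_eq_two_images (fdcCorner k b) (fdcCorner k (b + Pi.single i 1))
    (fun δ'' : FdcP => δ'' i = 0) inj₁ inj₂ (fun δ' δ'' h => fdcCorner_ne_of_eq_zero hk b i δ' δ'' h)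
    _ ?_]
  · refine congrArg₂ (fun z w : ℂ => z * w) ?_ ?_
    · refine prod_congr rfl fun δ' _ => ?_
      rw [cornerOp_apply_blk inj₁]
      by_cases hδ' : δ' i = 0
      · have hc : fdcCorner k b δ' = fdcCorner k (b + Pi.single i 1) (δ' + Pi.single i 1) :=
          ((fdcCorner_eq_iff hk b i δ' (δ' + Pi.single i 1)).2 ⟨hδ', rfl⟩).symm
        rw [if_pos hδ', hc, cornerOp_apply_blk inj₂]
        rfl
      · have hne : ∀ δ'', fdcCorner k (b + Pi.single i 1) δ'' ≠ fdcCorner k b δ' := fun δ'' h =>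
          hδ' ((fdcCorner_eq_iff hk b i δ' δ'').1 h).1
        rw [if_neg hδ', cornerOp_apply_of_ne _ id _ hne, one_mulVec]
        rfl
    · refine prod_congr rfl fun δ'' _ => ?_
      by_cases hδ'' : δ'' i = 0
      · rw [if_pos hδ'', if_pos hδ'', cornerOp_apply_blk inj₂,
          cornerOp_apply_of_ne _ id _ (fun δ' => fdcCorner_ne_of_eq_zero hk b i δ' δ'' hδ''),
          one_mulVec]
        rfl
      · rw [if_neg hδ'', if_neg hδ'']
  · intro a ha₁ ha₂
    have hb₂ : ∀ δ'', fdcCorner k (b + Pi.single i 1) δ'' ≠ a := by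
      intro δ'' h
      by_cases hδ'' : δ'' i = 0
      · exact ha₂ δ'' hδ'' h
      · rw [fdcCorner_add_single_of_ne b i δ'' hδ''] at h
        exact ha₁ _ h
    rw [cornerOp_apply_of_ne _ id _ ha₁, cornerOp_apply_of_ne _ id _ hb₂, one_mulVec, one_mulVec, hφ]

omit [NeZero L] in
/-- **The four-cluster product** of a plaquette: one-point factors over its corners. [folklore] -/
theorem fdc_prod_cornersB (hk : 3 ≤ k) (φ : TensorIndex FdcP q → ℂ) (hφ : star φ ⬝ᵥ φ = 1)
    (b : FdcA k) (l l' : TensorIndex FdcP q) :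
    ∏ a : FdcA k, (star φ ⬝ᵥ
        (cornerOp (fdcCorner k b) id (fun g => single (l g) (l' g) (1 : ℂ)) a *ᵥ φ)) =
      ∏ δ' : FdcP, fdcS φ δ' (l δ') (l' δ') := by
  have inj₁ := fdcCorner_injective hk b
  rw [prod_univ_eq_two_images (fdcCorner k b) (fdcCorner k b) (fun _ : FdcP => False) inj₁ inj₁
    (fun _ _ h _ => h) _ fun a ha₁ _ => by rw [cornerOp_apply_of_ne _ id _ ha₁, one_mulVec, hφ]]
  simp only [if_false, prod_const_one, mul_one]
  refine prod_congr rfl fun δ' _ => ?_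
  rw [cornerOp_apply_blk inj₁]
  rfl

/-- **Two-plaquette contraction**: `⟨Ψ₀, Xᵇ Xᵇ⁺ᵉ Ψ₀⟩ = fdcSumA` for `Ψ₀ = ⨂_{clusters} φ`,
`‖φ‖ = 1`, `k ≥ 3`. [folklore] -/
theorem fdc_contractA (hk : 3 ≤ k) (hkL : k * 2 = L) (φ : TensorIndex FdcP q → ℂ)
    (hφ : star φ ⬝ᵥ φ = 1) (b : FdcA k) (i : Fin 2) (X1 X2 : Op FdcP q) :
    star (blockProductStates (fdcEA hkL) fun _ => φ) ⬝ᵥ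
        (spinEmbed (blockEmb (fdcEB hkL) b) X1 *ᵥ
          (spinEmbed (blockEmb (fdcEB hkL) (b + Pi.single i 1)) X2 *ᵥ
            blockProductStates (fdcEA hkL) fun _ => φ)) =
      fdcSumA φ i X1 X2 := by
  have h₁ : ∀ δ', fdcEA hkL (blockEmb (fdcEB hkL) b δ') = (fdcCorner k b δ', id δ') :=
    fdcEA_blockEmb hkL b
  have h₂ : ∀ δ'', fdcEA hkL (blockEmb (fdcEB hkL) (b + Pi.single i 1) δ'') =
      (fdcCorner k (b + Pi.single i 1) δ'', id δ'') := fdcEA_blockEmb hkL _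
  have inj₁ := fdcCorner_injective hk b
  have inj₂ := fdcCorner_injective hk (b + Pi.single i 1)
  rw [spinEmbed_mulVec_blockProductStates (fdcEA hkL) h₂ inj₂, mulVec_sum, dotProduct_sum]
  refine sum_congr rfl fun l₂ _ => ?_
  rw [mulVec_sum, dotProduct_sum]
  refine sum_congr rfl fun l₂' _ => ?_
  rw [mulVec_smul, dotProduct_smul, expect_spinEmbed_blockProductStates (fdcEA hkL) h₁ inj₁,
    smul_eq_mul, mul_sum]
  refine sum_congr rfl fun l₁ _ => ?_
  rw [mul_sum]
  refine sum_congr rfl fun l₁' _ => ?_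
  rw [fdc_prod_cornersA hk φ hφ b i l₁ l₁' l₂ l₂']

/-- **One-plaquette contraction**: `⟨Ψ₀, Xᵇ Ψ₀⟩ = fdcSumB`. [folklore] -/
theorem fdc_contractB (hk : 3 ≤ k) (hkL : k * 2 = L) (φ : TensorIndex FdcP q → ℂ)
    (hφ : star φ ⬝ᵥ φ = 1) (b : FdcA k) (X : Op FdcP q) :
    star (blockProductStates (fdcEA hkL) fun _ => φ) ⬝ᵥ
        (spinEmbed (blockEmb (fdcEB hkL) b) X *ᵥ blockProductStates (fdcEA hkL) fun _ => φ) =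
      fdcSumB φ X := by
  have h₁ : ∀ δ', fdcEA hkL (blockEmb (fdcEB hkL) b δ') = (fdcCorner k b δ', id δ') :=
    fdcEA_blockEmb hkL b
  rw [expect_spinEmbed_blockProductStates (fdcEA hkL) h₁ (fdcCorner_injective hk b)]
  refine sum_congr rfl fun l _ => sum_congr rfl fun l' _ => ?_
  rw [fdc_prod_cornersB hk φ hφ b l l']

end Contraction

/-! ### The pair expectation in the circuit state -/

section Pair

variable {k L : ℕ} [NeZero k] [NeZero L] {q : ℕ}

/-- **Light cone of a bond**: `⟨U Ψ₀, (s at x)(s' at x + eᵢ) U Ψ₀⟩ = fdcPair φ u δ i s s'` where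
`δ` is the parity of `x`; `U = ⨂_{plaquettes} u` (`u† u = 1`), `Ψ₀ = ⨂_{clusters} φ` (`‖φ‖ = 1`),
`k ≥ 3`. [folklore] -/
theorem fdc_expect_pair (hk : 3 ≤ k) (hkL : k * 2 = L) (φ : TensorIndex FdcP q → ℂ)
    (hφ : star φ ⬝ᵥ φ = 1) (u : Op FdcP q) (hu : uᴴ * u = 1) (x : TorusSite 2 L) (i : Fin 2)
    (s s' : Matrix (Fin q) (Fin q) ℂ) :
    star (blockProductOp (fdcEB hkL) (fun _ => u) *ᵥ blockProductStates (fdcEA hkL) fun _ => φ) ⬝ᵥ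
        ((onSite x s * onSite (x + Pi.single i 1) s') *ᵥ
          (blockProductOp (fdcEB hkL) (fun _ => u) *ᵥ
            blockProductStates (fdcEA hkL) fun _ => φ)) =
      fdcPair φ u (fdcEA hkL x).2 i s s' := by
  set U := blockProductOp (fdcEB hkL) (fun _ => u) with hU
  have hUU : U * Uᴴ = 1 := blockProductOp_mul_conjTranspose_self _ hu
  have huu : u * uᴴ = 1 := mul_eq_one_comm.1 hu
  have hx : fdcEB hkL x = ((fdcEB hkL x).1, (fdcEA hkL x).2) := rfl
  rw [expect_mulVec_conj, conj_mul_of_mul_conjTranspose_eq_one hUU, hU,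
    conj_onSite_blockProductOp (fdcEB hkL) hu hx s]
  unfold fdcPair
  by_cases hδ : (fdcEA hkL x).2 i = 0
  · rw [if_pos hδ, conj_onSite_blockProductOp (fdcEB hkL) hu
      (fdcEB_add_single_of_eq_zero hkL x i hδ) s', ← mulVec_mulVec]
    exact fdc_contractA hk hkL φ hφ _ i _ _
  · rw [if_neg hδ, conj_onSite_blockProductOp (fdcEB hkL) hu
      (fdcEB_add_single_of_ne_zero hkL x i hδ) s', ← map_mul]
    have hX : uᴴ * onSite (fdcEA hkL x).2 s * u *
        (uᴴ * onSite ((fdcEA hkL x).2 + Pi.single i 1) s' * u) =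
        uᴴ * (onSite (fdcEA hkL x).2 s * onSite ((fdcEA hkL x).2 + Pi.single i 1) s') * u := by
      calc uᴴ * onSite (fdcEA hkL x).2 s * u *
            (uᴴ * onSite ((fdcEA hkL x).2 + Pi.single i 1) s' * u)
          = uᴴ * onSite (fdcEA hkL x).2 s * (u * uᴴ) *
              onSite ((fdcEA hkL x).2 + Pi.single i 1) s' * u := by noncomm_ring
        _ = _ := by rw [huu]; noncomm_ring
    rw [hX]
    exact fdc_contractB hk hkL φ hφ _ _

end Pair

/-! ### The variational bound -/

section Main

variable {k L : ℕ} [NeZero k] [NeZero L]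

/-- **The bond expectation** `⟨Ψ, S_x · S_{x+eᵢ} Ψ⟩ = fdcBond n φ u δ i`, `δ` the parity of `x`.
[folklore] -/
theorem fdc_expect_spinDot (n : ℕ) (hk : 3 ≤ k) (hkL : k * 2 = L)
    (φ : TensorIndex FdcP (n + 1) → ℂ) (hφ : star φ ⬝ᵥ φ = 1) (u : Op FdcP (n + 1))
    (hu : uᴴ * u = 1) (x : TorusSite 2 L) (i : Fin 2) :
    star (blockProductOp (fdcEB hkL) (fun _ => u) *ᵥ blockProductStates (fdcEA hkL) fun _ => φ) ⬝ᵥ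
        (spinDot n x (x + Pi.single i 1) *ᵥ
          (blockProductOp (fdcEB hkL) (fun _ => u) *ᵥ
            blockProductStates (fdcEA hkL) fun _ => φ)) =
      fdcBond n φ u (fdcEA hkL x).2 i := by
  have hL : 2 ≤ L := by omega
  rw [LiebMattis.spinDot_eq_of_ne n (torusSite_ne_add_single hL x i), add_mulVec, Matrix.smul_mulVec,
    add_mulVec, dotProduct_add, dotProduct_smul, dotProduct_add,
    fdc_expect_pair hk hkL φ hφ u hu, fdc_expect_pair hk hkL φ hφ u hu,
    fdc_expect_pair hk hkL φ hφ u hu, smul_eq_mul]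
  rfl

/-- **Exact energy of the circuit state**: `Re ⟨Ψ, H_L Ψ⟩ = J k² Φ(φ, u)`. [folklore] -/
theorem re_expect_heisenbergHamiltonian_fdc (n : ℕ) (J : ℝ) (hk : 3 ≤ k) (hkL : k * 2 = L)
    (φ : TensorIndex FdcP (n + 1) → ℂ) (hφ : star φ ⬝ᵥ φ = 1) (u : Op FdcP (n + 1))
    (hu : uᴴ * u = 1) :
    (star (blockProductOp (fdcEB hkL) (fun _ => u) *ᵥ
          blockProductStates (fdcEA hkL) fun _ => φ) ⬝ᵥ
        (heisenbergHamiltonian n (torusGraph 2 L) J *ᵥ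
          (blockProductOp (fdcEB hkL) (fun _ => u) *ᵥ
            blockProductStates (fdcEA hkL) fun _ => φ))).re =
      J * (k : ℝ) ^ 2 * fdcEnergy n φ u := by
  have hL : 3 ≤ L := by omega
  rw [re_expect_heisenbergHamiltonian_torus n hL J]
  set t : FdcP → Fin 2 → ℝ := fun δ i => (fdcBond n φ u δ i).re with ht
  have hsum : ∑ x : TorusSite 2 L, ∑ i : Fin 2,
      (star (blockProductOp (fdcEB hkL) (fun _ => u) *ᵥ
            blockProductStates (fdcEA hkL) fun _ => φ) ⬝ᵥ
          (spinDot n x (x + Pi.single i 1) *ᵥ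
            (blockProductOp (fdcEB hkL) (fun _ => u) *ᵥ
              blockProductStates (fdcEA hkL) fun _ => φ))).re =
      (k : ℝ) ^ 2 * fdcEnergy n φ u := by
    calc _ = ∑ x : TorusSite 2 L, ∑ i : Fin 2, t (fdcEA hkL x).2 i :=
          sum_congr rfl fun x _ => sum_congr rfl fun i _ => by
            rw [fdc_expect_spinDot n hk hkL φ hφ u hu x i]
      _ = ∑ p : FdcA k × FdcP, ∑ i : Fin 2, t p.2 i :=
          (fdcEA hkL).sum_comp (fun p => ∑ i : Fin 2, t p.2 i)
      _ = ∑ _c : FdcA k, ∑ δ : FdcP, ∑ i : Fin 2, t δ i := Fintype.sum_prod_type _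
      _ = (k : ℝ) ^ 2 * fdcEnergy n φ u := by
          rw [sum_const, card_univ, card_fdcA, nsmul_eq_mul]
          push_cast
          rfl
  rw [hsum]
  ring

/-- **FDC variational upper bound for the Heisenberg torus**: for `L = 2k`, `k ≥ 3`, any spin
`n/2`, any real `J`, every unit cluster vector `φ` on a `2×2` cluster and every unitary `u` on a
`2×2` dual plaquette, `E₀(H_L) ≤ J k² Φ(φ, u)` with `Φ = fdcEnergy n φ u`; the trial state is the
depth-(2×2) circuit state `(⨂_{plaquettes} u)(⨂_{clusters} φ)`. Tasaki (2020) §2.5 (variational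
principle with tensor-network states). [folklore] -/
theorem heisenbergTorus_groundEnergy_le_fdc (n : ℕ) (J : ℝ) (hk : 3 ≤ k) (hkL : k * 2 = L)
    (φ : TensorIndex FdcP (n + 1) → ℂ) (hφ : star φ ⬝ᵥ φ = 1) (u : Op FdcP (n + 1))
    (hu : uᴴ * u = 1) :
    (heisenbergHamiltonian n (torusGraph 2 L) J).groundEnergy ≤ J * (k : ℝ) ^ 2 * fdcEnergy n φ u := by
  haveI : Nonempty (TensorIndex (TorusSite 2 L) (n + 1)) := ⟨fun _ => 0⟩
  have hH := heisenbergHamiltonian_isHermitian (Λ := TorusSite 2 L) n (torusGraph 2 L) J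
  have hU := conjTranspose_blockProductOp_mul_self (fdcEB hkL) fun _ : FdcA k => hu
  have hΨ1 : star (blockProductOp (fdcEB hkL) (fun _ => u) *ᵥ
        blockProductStates (fdcEA hkL) fun _ => φ) ⬝ᵥ
      (blockProductOp (fdcEB hkL) (fun _ => u) *ᵥ blockProductStates (fdcEA hkL) fun _ => φ) = 1 := by
    rw [star_mulVec_dotProduct_mulVec_of_unitary hU, star_blockProductStates_const_dotProduct_self,
      hφ, one_pow]
  have hvar := Matrix.groundEnergy_le_rayleigh_holds hH _ hΨ1
  rwa [re_expect_heisenbergHamiltonian_fdc n J hk hkL φ hφ u hu] at hvar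

end Main

end

end Summit.HubbardSuperconductivity.HubbardLadder.Bounds
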